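import Summits.QuantumFields.YangMills.Theorems.LangevinControlUVOSLegsFromFemtoAndGapDefs
import HarnessLib

/-!
# Route `LangevinControlUV`, crux `OSLegsAtWeakCouplingC` (stmt-QuantumFields-16207): vocabulary of line `inherited-amplitude-gates`

Route-posited objects (D-0016 `<Route><Crux>…Defs` file) shared by the registered stubs of the skeleton
`Cruxes/OSLegsAtWeakCouplingC/Lines/inherited_amplitude_gates.lean` (planner
`planner-cruxplan-stmt-QuantumFields-16207-inherited-amplitude--0`, lead `prover-line-stmt-QuantumFields-16207-a1-0`) and by the
Theorems files proving those stubs: VERBATIM the skeleton's §1 declarations, in the SAME namespace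
`Summit.QuantumFields.YangMills.Cruxes.OSLegsAtWeakCouplingC.InheritedAmplitudeGates`, so that the registered signatures
(`stub_inherit : … → FC2I G r a`, `stub_lowerI : … → FC2I G r a → FC3 G r a → LowerBounds G r a`, `stub_gates : … → GateAxis G r a ∧
GateD G r a`, `stub_tame : … → FlatShape2 G r a ∧ FitWindow G r a`) elaborate unchanged against this file.  NOTHING is asserted: every
`def … : Prop` is a line statement some registered stub proves or consumes (none is a literature fact, none restates the crux).
Vocabulary of the predecessor line `dlr-collar-transfer` (`kerE`, `kerCov`, `depth`, `plane`, `dens`, `LGConfig`, …) from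
`LangevinControlUVOSLegsFromFemtoAndGapDefs.lean`.

* `GateAxis` — the η-relative, scale-free covariance gate at the `(0,1)`-plane / `e₂`-axis pairs H1 pins (engine-grade);
* `GateD`    — the same gate for the action density, all directions (engine-grade);
* `FlatShape2` — two-sided shape comparison density ↔ axis pair in the FLAT-walled femto box (one exterior);
* `FitWindow` — the open-window fit `K (n a)⁸ ≤ n⁸ Cov` on H1's own femto-torus witnesses, on a swept β-window;
* `FC2I` — the inherited conditional two-point package for the action density ((U) absolute hyperscaling bound, (L) windowed
  floor uniform in the room it leaves) — proved by `stub_inherit`, consumed by `stub_lowerI`.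

Refs: line card `Cruxes/OSLegsAtWeakCouplingC/Lines/inherited-amplitude-gates.md`; idea card `Ideas/inherited-amplitude-gates.md`;
Disproof `Cruxes/OSLegsAtWeakCouplingC/Disproof.lean` (v2); Georgii2011 Ch. 8 (DLR kernels, boundary influence); LuscherEtAl1992 §2
(Schrödinger functional / flat walls); Balaban1989LargeFieldII (background fields).
-/

set_option autoImplicit false

noncomputable section

open scoped BigOperators
open MeasureTheory Filter Topology
open Literature.MathematicalPhysics.QuantumFieldTheory Literature.MathematicalPhysics.QuantumLattice
open Literature.MathematicalPhysics.AQFT Literature.Probability.LatticeModels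
open Summit.QuantumFields.YangMills.Cruxes.OSLegsFromFemtoAndGap.DlrCollarTransfer

namespace Summit.QuantumFields.YangMills.Cruxes.OSLegsAtWeakCouplingC.InheritedAmplitudeGates

section Lattice

variable (G : Type) [Group G] [TopologicalSpace G] [IsTopologicalGroup G] [CompactSpace G]
  [MeasurableSpace G] [BorelSpace G] (r : LatticeRep G) (a : ℝ → ℝ)

/-- **GateAxis — the η-RELATIVE, scale-free covariance gate at the pairs H1 pins** (ENGINE-GRADE).  One universal
`C` (BEFORE `∀ κ`): for `β ≥ β₆`, every femto cube `(c, b)` (`b·a(β) ≤ ℓ₆`), every exterior `η`, every `(0,1)`-plane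
pair `(x, x + n e₂)` (`n ≥ n₆`) at depth `≥ κ n` (`κ ≥ 8`), and every `M ≥ 0` bounding the exterior-induced shifts
`|E_η P − E_1 P|` of ALL six single-plane plaquette means on the sites of depth `≥ (κ−2) n`:
`|K(η) − K(1)| ≤ C · (M · √K(1) + M² + |K(1)| / κ²)`, `K(·)` the conditional covariance of the pair under the cube
kernel, `1` the FLAT exterior (all exterior links = identity).  No `a`-power, no `Γ`, no positivity claim, no division:
the exterior acts only through the background it induces (mean shift `M ≍ F_bg²`, cross term `≍ M √K(1)`, kernel change
`≲ K(1)·(F_bg n²) ≍ K(1) κ⁻²` — stated at FIRST order although second order `κ⁻⁴` is expected (adjoint colour trace), the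
solve step needing only `C κ⁻² ≤ 1/4`); exact with `C = 2√2` in the Gaussian proxy (ideator 2, kit j008782).  Restricted to the `e₂`-AXIS pairs of the `(0,1)` plane (triage r1-1 (i) / r1-2 defect 1b: on the
cone `x₀²+x₁² = x₂²+x₃²` the single-plane tree covariance vanishes and a multiplicative gate is unsafe; at axis pairs
`D^{(01),(01)}(n e₂) = 1/(π² n⁴) ≠ 0`). -/
def GateAxis : Prop :=
  ∃ (C β₆ ℓ₆ : ℝ) (n₆ : ℕ), 0 < C ∧ 0 < ℓ₆ ∧ 1 ≤ n₆ ∧ ∀ β : ℝ, β₆ ≤ β → ∀ κ : ℕ, 8 ≤ κ →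
    ∀ (c : Fin 4 → ℤ) (b : ℕ), (b : ℝ) * a β ≤ ℓ₆ → ∀ (η : LGConfig 4 G) (x : Fin 4 → ℤ) (n : ℕ), n₆ ≤ n →
      κ * n ≤ depth c b x → κ * n ≤ depth c b (x + Pi.single (2 : Fin 4) (n : ℤ)) →
      ∀ M : ℝ, 0 ≤ M →
        (∀ (q : Fin 4 × Fin 4) (z : Fin 4 → ℤ), q.1 < q.2 → (κ - 2) * n ≤ depth c b z →
          |kerE G r β c b η (plane G r q z) - kerE G r β c b 1 (plane G r q z)| ≤ M) →
        |kerCov G r β c b η (plane G r (0, 1) x) (plane G r (0, 1) (x + Pi.single (2 : Fin 4) (n : ℤ))) -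
            kerCov G r β c b 1 (plane G r (0, 1) x) (plane G r (0, 1) (x + Pi.single (2 : Fin 4) (n : ℤ)))| ≤
          C * (M * Real.sqrt (kerCov G r β c b 1 (plane G r (0, 1) x) (plane G r (0, 1) (x + Pi.single (2 : Fin 4) (n : ℤ)))) +
            M ^ 2 + |kerCov G r β c b 1 (plane G r (0, 1) x) (plane G r (0, 1) (x + Pi.single (2 : Fin 4) (n : ℤ)))| / (κ : ℝ) ^ 2)

/-- **GateD — the same η-relative gate for the ACTION DENSITY, all directions** (ENGINE-GRADE; triage r1-1 sharpen (2) /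
r1-2 defect 1: the observable actually propagated to every exterior is `dens = Σ_{i<j} plane (i,j)`, whose flat two-point
function `Σ_{q,q'} 2 (D^{qq'})² ≍ 12/(π⁴|y−x|⁸)` is a sum of squares, non-degenerate in EVERY direction, the background again
entering at second order).  Same quantifier shape as `GateAxis` with an arbitrary pair `x, y`, `‖y − x‖ ≥ n₆`, depths
`≥ κ‖y−x‖`, budget sites at depth `≥ (κ−2)‖y−x‖`. -/
def GateD : Prop :=
  ∃ (C β₆ ℓ₆ : ℝ) (n₆ : ℕ), 0 < C ∧ 0 < ℓ₆ ∧ 1 ≤ n₆ ∧ ∀ β : ℝ, β₆ ≤ β → ∀ κ : ℕ, 8 ≤ κ →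
    ∀ (c : Fin 4 → ℤ) (b : ℕ), (b : ℝ) * a β ≤ ℓ₆ → ∀ (η : LGConfig 4 G) (x y : Fin 4 → ℤ),
      (n₆ : ℝ) ≤ ‖siteToE (y - x)‖ →
      (κ : ℝ) * ‖siteToE (y - x)‖ ≤ depth c b x → (κ : ℝ) * ‖siteToE (y - x)‖ ≤ depth c b y →
      ∀ M : ℝ, 0 ≤ M →
        (∀ (q : Fin 4 × Fin 4) (z : Fin 4 → ℤ), q.1 < q.2 → ((κ : ℝ) - 2) * ‖siteToE (y - x)‖ ≤ depth c b z →
          |kerE G r β c b η (plane G r q z) - kerE G r β c b 1 (plane G r q z)| ≤ M) →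
        |kerCov G r β c b η (dens G r x) (dens G r y) - kerCov G r β c b 1 (dens G r x) (dens G r y)| ≤
          C * (M * Real.sqrt (kerCov G r β c b 1 (dens G r x) (dens G r y)) + M ^ 2 +
            |kerCov G r β c b 1 (dens G r x) (dens G r y)| / (κ : ℝ) ^ 2)

/-- **FlatShape2 — dimensionless shape facts for the FLAT-walled femto box only** (ENGINE-GRADE but ONE exterior, `η = 1`,
toron-free: the frozen flat boundary removes the constant modes; lattice Schrödinger-functional setting).  Plane-sum /
cross-term control and cone comparability as ONE two-sided comparison: the flat conditional covariance of the action density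
at a pair `(x, y)` deep in the box is comparable (factor `θ`) to the flat `(0,1)`-plane covariance at ANY `e₂`-axis pair
`(x', x' + m e₂)` of comparable length (`‖y−x‖ ≤ m ≤ 2‖y−x‖`) and comparable depth in the same box, at the same `β`.  Tree
level `12/|y−x|⁸` against `2/m⁸`: ratio in `[6, 6·2⁸]` in every direction; flat-wall images `O(κ₇⁻²)`, loops `O(g²)`. -/
def FlatShape2 : Prop :=
  ∃ (θ β₇ ℓ₇ : ℝ) (κ₇ n₇ : ℕ), 0 < θ ∧ 0 < ℓ₇ ∧ ∀ β : ℝ, β₇ ≤ β →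
    ∀ (c : Fin 4 → ℤ) (b : ℕ), (b : ℝ) * a β ≤ ℓ₇ → ∀ (x y x' : Fin 4 → ℤ) (m : ℕ),
      (n₇ : ℝ) ≤ ‖siteToE (y - x)‖ → ‖siteToE (y - x)‖ ≤ m → (m : ℝ) ≤ 2 * ‖siteToE (y - x)‖ →
      (κ₇ : ℝ) * m ≤ depth c b x → (κ₇ : ℝ) * m ≤ depth c b y →
      (κ₇ : ℝ) * m ≤ depth c b x' → (κ₇ : ℝ) * m ≤ depth c b (x' + Pi.single (2 : Fin 4) (m : ℤ)) →
        θ * kerCov G r β c b 1 (plane G r (0, 1) x') (plane G r (0, 1) (x' + Pi.single (2 : Fin 4) (m : ℤ))) ≤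
          kerCov G r β c b 1 (dens G r x) (dens G r y) ∧
        θ * kerCov G r β c b 1 (dens G r x) (dens G r y) ≤
          kerCov G r β c b 1 (plane G r (0, 1) x') (plane G r (0, 1) (x' + Pi.single (2 : Fin 4) (m : ℤ)))

/-- **FitWindow — the open-window fit on H1's own witnesses** (triage r1-2 defect 2, repaired signature; the ONLY place the
inherited architecture needs more than H1's logical form).  Beyond every threshold `β'` and inside every femto range `ℓ'`
there are a femto torus side `L`, an axis separation `n` (`8n ≤ L`) and a β-interval `[β₁, β₂]` on which `a` is NOT
constant such that the dimensionless axis amplitude beats `K (n a β)⁸` for EVERY prescribed `K`: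
`K (n a(β))⁸ ≤ n⁸ · Cov_{β,L}(P^{01}_0, P^{01}_{n e₂})` for all `β ∈ [β₁, β₂]` (H1's own presentation).  With H1's UPPER
bound this says `Γ(s) ≥ (K/C) s⁸` on the non-degenerate interval of scales `s = n a(β)` swept (IVT, `Continuous a`).
Physically `Γ(s) ≍ g(s)⁴ ≫ s⁸`; formally it follows from two-sided fixed-torus semiclassics (`Cov_{β,L} ≍ β⁻²`) for every
unit map decaying faster than `β^{-1/4}` — so it fails only for non-asymptotically-free unit maps, which H1–H3 do not
formally exclude (Disproof §1 wall: not refutable either). -/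
def FitWindow : Prop :=
  ∀ (K β' ℓ' : ℝ), 0 < ℓ' → ∃ (L : ℕ) (_ : NeZero L) (β₁ β₂ : ℝ) (n : ℕ), β' ≤ β₁ ∧ β₁ ≤ β₂ ∧ a β₁ ≠ a β₂ ∧
    1 ≤ n ∧ 8 * n ≤ L ∧ ∀ β : ℝ, β₁ ≤ β → β ≤ β₂ → (L : ℝ) * a β ≤ ℓ' ∧
      K * ((n : ℝ) * a β) ^ 8 ≤ (n : ℝ) ^ 8 *
        (wilsonExpectation (d := 4) (L := L) r.ρ β
            (fun U => ((r.N : ℝ) - (r.ρ (plaquetteHolonomy U 0 0 1)).trace.re) *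
              ((r.N : ℝ) - (r.ρ (plaquetteHolonomy U (Pi.single (2 : Fin 4) ((n : ℕ) : ZMod L)) 0 1)).trace.re)) -
          wilsonExpectation (d := 4) (L := L) r.ρ β (fun U => (r.N : ℝ) - (r.ρ (plaquetteHolonomy U 0 0 1)).trace.re) *
            wilsonExpectation (d := 4) (L := L) r.ρ β
              (fun U => (r.N : ℝ) - (r.ρ (plaquetteHolonomy U (Pi.single (2 : Fin 4) ((n : ℕ) : ZMod L)) 0 1)).trace.re))

/-- **FC2I — the INHERITED conditional two-point package for the action density** (the interface `stub_inherit` proves and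
`stub_lowerI` consumes; no shape function, no growth clause).  (U) UNCONDITIONAL hyperscaling bound: for `β ≥ β₂`, every
femto cube (`b·a(β) ≤ ℓ₂`), every exterior `η`, every pair `‖y−x‖ ≥ n₀` at depth `≥ κ₂‖y−x‖`:
`|‖y−x‖⁸ · kerCov_η(dens_x, dens_y)| ≤ C₂` (BOTH signs — what the three-point transfer uses for the mixed terms of the law of
total cumulance, in place of FC2's sandwich `cov_abs_bound`; needs no fit: `Γ ≤ 1` above, the budget terms below).
(L) WINDOWED floor, UNIFORM IN THE ROOM IT LEAVES (triage r1-2 defect 3: the consumer must beat FBL's boundary term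
`(2C₁/d⁴)²` inside a femto cube, i.e. needs `c₂ ≥ K_c s₂⁸` for ITS `K_c ≍ C₁²/ℓ⁸` and a collar `κ₃ s₂` that fits): for every
`K_c` and every `t > 0` there are a window `0 < s₁ < s₂ ≤ t`, a collar `κ₃` with `κ₃ s₂ ≤ t`, a floor `c₂ ≥ K_c s₂⁸` and a
threshold `β₃` such that for `β ≥ β₃`, femto cubes, every exterior and every pair at depth `≥ κ₃‖y−x‖` whose physical
separation `‖y−x‖·a(β)` lies in `[s₁, s₂]`: `c₂ ≤ ‖y−x‖⁸ · kerCov_η(dens_x, dens_y)`.  (`stub_inherit` delivers this by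
taking `FitWindow`'s `K` large: the inherited floor is `≍ K s₁⁸`, the needed collar `κ₃ s₂ ≍ (C₁²/K)^{1/8}`.) -/
def FC2I : Prop :=
  ∃ (β₂ ℓ₂ C₂ : ℝ) (κ₂ n₀ : ℕ), 0 < ℓ₂ ∧ 1 ≤ n₀ ∧
    (∀ β : ℝ, β₂ ≤ β → ∀ (c : Fin 4 → ℤ) (b : ℕ), (b : ℝ) * a β ≤ ℓ₂ → ∀ (η : LGConfig 4 G) (x y : Fin 4 → ℤ),
      (n₀ : ℝ) ≤ ‖siteToE (y - x)‖ →
      (κ₂ : ℝ) * ‖siteToE (y - x)‖ ≤ depth c b x → (κ₂ : ℝ) * ‖siteToE (y - x)‖ ≤ depth c b y →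
        |‖siteToE (y - x)‖ ^ 8 * kerCov G r β c b η (dens G r x) (dens G r y)| ≤ C₂) ∧
    (∀ (Kc t : ℝ), 0 < t → ∃ (s₁ s₂ c₂ β₃ : ℝ) (κ₃ : ℕ), 0 < s₁ ∧ s₁ < s₂ ∧ s₂ ≤ t ∧ (κ₃ : ℝ) * s₂ ≤ t ∧
      Kc * s₂ ^ 8 ≤ c₂ ∧
      ∀ β : ℝ, β₃ ≤ β → ∀ (c : Fin 4 → ℤ) (b : ℕ), (b : ℝ) * a β ≤ ℓ₂ → ∀ (η : LGConfig 4 G) (x y : Fin 4 → ℤ),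
        (n₀ : ℝ) ≤ ‖siteToE (y - x)‖ →
        (κ₃ : ℝ) * ‖siteToE (y - x)‖ ≤ depth c b x → (κ₃ : ℝ) * ‖siteToE (y - x)‖ ≤ depth c b y →
        s₁ ≤ ‖siteToE (y - x)‖ * a β → ‖siteToE (y - x)‖ * a β ≤ s₂ →
          c₂ ≤ ‖siteToE (y - x)‖ ^ 8 * kerCov G r β c b η (dens G r x) (dens G r y))

end Lattice

end Summit.QuantumFields.YangMills.Cruxes.OSLegsAtWeakCouplingC.InheritedAmplitudeGates

end
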